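import Summits.AtomisticToContinuum.Crystallization.Theses.GappedShellCensus
import Summits.AtomisticToContinuum.Crystallization.Theorems.ReggeStarCoercivityStarCoercivityCoarseTierTransfer
import Summits.AtomisticToContinuum.Crystallization.Theorems.ChargedEnergyGap.Negative.Unconditional
import Summits.AtomisticToContinuum.Crystallization.Theorems.GappedShellCensusRadialDefectsVanishStubRdvSeparatedPoints
import Summits.AtomisticToContinuum.Crystallization.Theorems.GappedShellCensusRadialDefectsVanishStubRdvGappedIff

/-!
# Crux `GappedShellCensus.RadialDefectsVanish` (stmt-AtomisticToContinuum-15930), line `Sketch`: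
# the transfer RADIAL TORUS RIGIDITY ⇒ RADIAL DEFECTS VANISH (sorry-free)

The kernel-checked reduction of the crux to its open core.  The hypothesis `hcore` of the main
theorem is the registered stub `stub_rdvTorusRigidity` of the line, verbatim (it is NOT asserted
here): ONE scale `a ∈ [47/50, 1]` at which near-minimising `δ`-separated periodic
configurations of `ℝ³` have at most `θ·#motif` radially bad motif points.  The theorem
`radialDefectsVanish_of_torusRigidity : core → RadialDefectsVanish` is Bridge B of card
radial-torus-rigidity, proved by periodising the ground states:

* ground states are `δ₀`-separated (`LennardJonesMinimalDistance_holds`, Literature, proved);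
* periodise `x^N` with long cubic periods (`CoarseTierTransfer.exists_periodicConfiguration`):
  the periodisation is `min δ₀ 2`-separated (`stub_rdvSeparatedPoints`), has `#motif = N`,
  energy per particle `≤ E_LJ(x^N)/N = E(N)/N` (`CoarseTierTransfer.energyPerParticle_le`), and
  its radially bad motif points are counted by the bad indices of `x^N` (`stub_rdvGappedIff`,
  `card_rdvBadMotif_eq`);
* `E(N)/N → e* = ⨅_Q e(Q)` (`ChargedEnergyGapNegative.crysEnergyLimit`, item 0626), so
  eventually `e(P_N) ≤ e* + η` and the core bounds the bad count by `θN` — eventually, hence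
  frequently, at the single scale `a`.

No definitions: the core is an explicit hypothesis of the transfer theorem (the line's skeleton
`Cruxes/RadialDefectsVanish/Lines/Sketch.lean` instantiates it with the stub).
-/

noncomputable section

open scoped BigOperators Classical

namespace Summit.AtomisticToContinuum.Crystallization.Theorems

open Literature.MathematicalPhysics.StatisticalMechanics
open Summit.AtomisticToContinuum.Crystallization.Theses.GappedShellCensus

/-- **Bad motif points of the periodisation are the bad indices** (`0 < a ≤ 1`): by
`stub_rdvGappedIff` and injectivity of `x`, the motif points of the long-period periodisation
`P` of `x` that are not gapped-twelve at scale `a` (read in `P.points`) are counted by the indices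
`i` that are not gapped-twelve in `x`. [folklore] -/
theorem card_rdvBadMotif_eq {N : ℕ} {x : Fin N → EuclideanSpace ℝ (Fin 3)}
    {P : PeriodicConfiguration 3} (hPm : P.motif = Finset.univ.image x)
    (hPl : ∀ g ∈ P.lattice, g ≠ 0 → 2 * ∑ k, ‖x k‖ + 2 ≤ ‖g‖) (hx : Function.Injective x)
    {a : ℝ} (ha : 0 < a) (ha1 : a ≤ 1) :
    (P.motif.filter fun y => ¬ ({w ∈ P.points | w ≠ y ∧ dist y w ≤ a * (1 + 1 / 50)}.ncard = 12 ∧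
        ∀ w ∈ P.points, w ≠ y → a * (1 - 1 / 50) ≤ dist y w ∧
          (dist y w ≤ a * (1 + 1 / 50) ∨ a * (63 / 50) ≤ dist y w))).card =
      Nat.card {i : Fin N // ¬ ((Finset.univ.filter fun j : Fin N =>
          j ≠ i ∧ dist (x i) (x j) ≤ a * (1 + 1 / 50)).card = 12 ∧
        ∀ j : Fin N, j ≠ i → a * (1 - 1 / 50) ≤ dist (x i) (x j) ∧
          (dist (x i) (x j) ≤ a * (1 + 1 / 50) ∨ a * (63 / 50) ≤ dist (x i) (x j)))} := by
  rw [hPm, Finset.filter_image, Finset.card_image_of_injective _ hx, Nat.card_eq_fintype_card,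
    Fintype.card_subtype]
  congr 1
  refine Finset.filter_congr fun i _ => ?_
  exact not_congr (stub_rdvGappedIff hPm hPl hx ha ha1 i)

/-- **From near-minimising periodic configurations to a finite configuration.**  If at scale
`a ∈ (0, 1]` every `δ`-separated periodic configuration with `e(P) ≤ e* + η` (`δ ≤ 2`) has at
most `θ·#motif` radially bad motif points, then every `δ`-separated finite injective
configuration `x : Fin N → ℝ³`, `N ≥ 1`, with `E_LJ(x)/N ≤ e* + η` has at most `θ·N` radially bad
indices (periodise with long cubic periods; separation, energy and bad counts transfer).
[folklore] -/
theorem card_rdvBad_le_of_periodic {a δ θ η : ℝ} (ha : 0 < a) (ha1 : a ≤ 1) (hδ2 : δ ≤ 2)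
    (hP : ∀ P : PeriodicConfiguration 3, (∀ u ∈ P.points, ∀ v ∈ P.points, u ≠ v → δ ≤ dist u v) →
      P.energyPerParticle lennardJones ≤
          (⨅ Q : PeriodicConfiguration 3, Q.energyPerParticle lennardJones) + η →
        ((P.motif.filter fun y => ¬ ({w ∈ P.points | w ≠ y ∧ dist y w ≤ a * (1 + 1 / 50)}.ncard = 12 ∧
            ∀ w ∈ P.points, w ≠ y → a * (1 - 1 / 50) ≤ dist y w ∧
              (dist y w ≤ a * (1 + 1 / 50) ∨ a * (63 / 50) ≤ dist y w))).card : ℝ)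
          ≤ θ * P.motif.card)
    {N : ℕ} (hN : 0 < N) {x : Fin N → EuclideanSpace ℝ (Fin 3)} (hx : Function.Injective x)
    (hsep : ∀ i j : Fin N, i ≠ j → δ ≤ dist (x i) (x j))
    (hE : interactionEnergy lennardJones x / N ≤
      (⨅ Q : PeriodicConfiguration 3, Q.energyPerParticle lennardJones) + η) :
    (Nat.card {i : Fin N // ¬ ((Finset.univ.filter fun j : Fin N =>
          j ≠ i ∧ dist (x i) (x j) ≤ a * (1 + 1 / 50)).card = 12 ∧
        ∀ j : Fin N, j ≠ i → a * (1 - 1 / 50) ≤ dist (x i) (x j) ∧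
          (dist (x i) (x j) ≤ a * (1 + 1 / 50) ∨ a * (63 / 50) ≤ dist (x i) (x j)))} : ℝ)
      ≤ θ * N := by
  obtain ⟨P, hPm, hPl⟩ := CoarseTierTransfer.exists_periodicConfiguration x hN
  have hPsep : ∀ u ∈ P.points, ∀ v ∈ P.points, u ≠ v → δ ≤ dist u v :=
    stub_rdvSeparatedPoints hPm hPl hδ2 hsep
  have heP : P.energyPerParticle lennardJones ≤
      (⨅ Q : PeriodicConfiguration 3, Q.energyPerParticle lennardJones) + η :=
    (CoarseTierTransfer.energyPerParticle_le hPm hPl hx hN).trans hE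
  have key := hP P hPsep heP
  have hcardm : (P.motif.card : ℝ) = N := by
    rw [hPm, Finset.card_image_of_injective _ hx]
    simp
  rw [card_rdvBadMotif_eq hPm hPl hx ha ha1, hcardm] at key
  exact key

/-- **RADIAL TORUS RIGIDITY ⇒ RADIAL DEFECTS VANISH** (Bridge B of card radial-torus-rigidity;
the crux of route GappedShellCensus, item stmt-AtomisticToContinuum-15930, from the line's open
core — the registered stub `stub_rdvTorusRigidity`, verbatim, taken here as the HYPOTHESIS
`hcore`: ONE scale `a ∈ [47/50, 1]` at which, for every separation `δ > 0` and every `θ > 0`,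
some `η > 0` makes every `δ`-separated periodic configuration with `e(P) ≤ e* + η` have at most
`θ·#motif` motif points that are not gapped-twelve at scale `a`).  Ground states are `δ₀`-separated (`LennardJonesMinimalDistance_holds`) and
have `E_LJ(x^N) = E(N)` with `E(N)/N → e*` (`ChargedEnergyGapNegative.crysEnergyLimit`); so for
every `θ > 0`, with `η` from the core at separation `min δ₀ 2`, eventually `E(N)/N ≤ e* + η` and
`card_rdvBad_le_of_periodic` bounds the radially bad sites of `x^N` by `θN` — eventually, hence
frequently, at the core's single scale `a`. [folklore] -/
theorem radialDefectsVanish_of_torusRigidity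
    (hcore : ∃ a : ℝ, 47 / 50 ≤ a ∧ a ≤ 1 ∧ ∀ δ : ℝ, 0 < δ → ∀ θ : ℝ, 0 < θ → ∃ η : ℝ, 0 < η ∧
      ∀ P : PeriodicConfiguration 3, (∀ u ∈ P.points, ∀ v ∈ P.points, u ≠ v → δ ≤ dist u v) →
        P.energyPerParticle lennardJones ≤
            (⨅ Q : PeriodicConfiguration 3, Q.energyPerParticle lennardJones) + η →
          ((P.motif.filter fun y => ¬ ({w ∈ P.points | w ≠ y ∧ dist y w ≤ a * (1 + 1 / 50)}.ncard = 12 ∧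
              ∀ w ∈ P.points, w ≠ y → a * (1 - 1 / 50) ≤ dist y w ∧
                (dist y w ≤ a * (1 + 1 / 50) ∨ a * (63 / 50) ≤ dist y w))).card : ℝ)
            ≤ θ * P.motif.card) :
    Summit.AtomisticToContinuum.Crystallization.Theses.GappedShellCensus.RadialDefectsVanish := by
  unfold Summit.AtomisticToContinuum.Crystallization.Theses.GappedShellCensus.RadialDefectsVanish
  intro x hx
  obtain ⟨a, ha0, ha1, hcore⟩ := hcore
  refine ⟨a, ha0, ha1, fun θ hθ => ?_⟩
  have ha : 0 < a := by linarith
  obtain ⟨δ₀, hδ₀, hsep⟩ := LennardJonesMinimalDistance_holds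
  obtain ⟨η, hη, hP⟩ := hcore (min δ₀ 2) (lt_min hδ₀ two_pos) θ hθ
  have hev : ∀ᶠ N : ℕ in Filter.atTop, groundStateEnergy lennardJones 3 N / N <
      (⨅ Q : PeriodicConfiguration 3, Q.energyPerParticle lennardJones) + η :=
    ChargedEnergyGapNegative.crysEnergyLimit.eventually (gt_mem_nhds (lt_add_of_pos_right _ hη))
  refine ((hev.and (Filter.eventually_gt_atTop 0)).mono fun N hN => ?_).frequently
  obtain ⟨hNE, hN0⟩ := hN
  have hE : interactionEnergy lennardJones (x N) / N ≤
      (⨅ Q : PeriodicConfiguration 3, Q.energyPerParticle lennardJones) + η := by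
    rw [(hx N).2]
    exact hNE.le
  exact card_rdvBad_le_of_periodic ha ha1 (min_le_right _ _) hP hN0 (hx N).1
    (fun i j hij => (min_le_left _ _).trans (hsep N (x N) (hx N) i j hij)) hE

/-! ## The sequential (weakest) form of the core also suffices -/

/-- **The energies per particle of the periodised ground states tend to `e*`.**  For `N ≥ 1` let
`P` be any long-period periodisation of the ground state `x^N` (motif `{xᵢᴺ}`); then
`e* ≤ e(P) ≤ E(N)/N` (`ChargedEnergyGapNegative.eStar_le`, `CoarseTierTransfer.energyPerParticle_le`
and `E_LJ(x^N) = E(N)`), and `E(N)/N → e*` (`ChargedEnergyGapNegative.crysEnergyLimit`); so along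
any choice of periodisations the energies are squeezed to `e*`. Stated for an arbitrary choice
function `P` with the two defining properties from index `1` on. [folklore] -/
theorem tendsto_energyPerParticle_periodised
    {x : (N : ℕ) → (Fin N → EuclideanSpace ℝ (Fin 3))}
    (hx : ∀ N, IsGroundState lennardJones (x N)) {P : ℕ → PeriodicConfiguration 3}
    (hPm : ∀ N, 0 < N → (P N).motif = Finset.univ.image (x N))
    (hPl : ∀ N, 0 < N → ∀ g ∈ (P N).lattice, g ≠ 0 → 2 * ∑ k, ‖x N k‖ + 2 ≤ ‖g‖) :
    Filter.Tendsto (fun N => (P N).energyPerParticle lennardJones) Filter.atTop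
      (nhds (⨅ Q : PeriodicConfiguration 3, Q.energyPerParticle lennardJones)) := by
  refine tendsto_of_tendsto_of_tendsto_of_le_of_le' tendsto_const_nhds
    ChargedEnergyGapNegative.crysEnergyLimit
    (Filter.Eventually.of_forall fun N => ChargedEnergyGapNegative.eStar_le (P N)) ?_
  filter_upwards [Filter.eventually_gt_atTop 0] with N hN
  have h1 := CoarseTierTransfer.energyPerParticle_le (hPm N hN) (hPl N hN) (hx N).1 hN
  rwa [(hx N).2] at h1

/-- **SEQUENTIAL RADIAL TORUS RIGIDITY ⇒ RADIAL DEFECTS VANISH.**  The weakest torus hypothesis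
the periodisation argument needs: for every separation `δ > 0` and every SEQUENCE of `δ`-separated
periodic configurations whose energies per particle tend to `e*`, there is ONE scale
`a ∈ [47/50, 1]` such that for every `θ > 0`, frequently along the sequence, at most `θ·#motif`
motif points are not gapped-twelve at scale `a` (quantifier shape of the crux itself: the scale
may depend on the sequence, and only `∃ᶠ` is asked).  Implied by the uniform core of
`radialDefectsVanish_of_torusRigidity`; applied to the periodised ground states
(`tendsto_energyPerParticle_periodised`, `stub_rdvSeparatedPoints`, `card_rdvBadMotif_eq`) it
gives the crux. [folklore] -/
theorem radialDefectsVanish_of_seqTorusRigidity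
    (hseq : ∀ δ : ℝ, 0 < δ → ∀ P : ℕ → PeriodicConfiguration 3,
      (∀ n, ∀ u ∈ (P n).points, ∀ v ∈ (P n).points, u ≠ v → δ ≤ dist u v) →
      Filter.Tendsto (fun n => (P n).energyPerParticle lennardJones) Filter.atTop
        (nhds (⨅ Q : PeriodicConfiguration 3, Q.energyPerParticle lennardJones)) →
      ∃ a : ℝ, 47 / 50 ≤ a ∧ a ≤ 1 ∧ ∀ θ : ℝ, 0 < θ → ∃ᶠ n in Filter.atTop,
        (((P n).motif.filter fun y => ¬ ({w ∈ (P n).points | w ≠ y ∧ dist y w ≤ a * (1 + 1 / 50)}.ncard = 12 ∧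
            ∀ w ∈ (P n).points, w ≠ y → a * (1 - 1 / 50) ≤ dist y w ∧
              (dist y w ≤ a * (1 + 1 / 50) ∨ a * (63 / 50) ≤ dist y w))).card : ℝ)
          ≤ θ * (P n).motif.card) :
    Summit.AtomisticToContinuum.Crystallization.Theses.GappedShellCensus.RadialDefectsVanish := by
  unfold Summit.AtomisticToContinuum.Crystallization.Theses.GappedShellCensus.RadialDefectsVanish
  intro x hx
  obtain ⟨δ₀, hδ₀, hsep⟩ := LennardJonesMinimalDistance_holds
  -- a periodisation of every `x^N`, `N ≥ 1` (index `0`: periodise the one-point `x^1` instead)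
  have hper : ∀ N : ℕ, ∃ P : PeriodicConfiguration 3, 0 < N →
      P.motif = Finset.univ.image (x N) ∧ ∀ g ∈ P.lattice, g ≠ 0 → 2 * ∑ k, ‖x N k‖ + 2 ≤ ‖g‖ := by
    intro N
    rcases Nat.eq_zero_or_pos N with rfl | hN
    · obtain ⟨P, -, -⟩ := CoarseTierTransfer.exists_periodicConfiguration (x 1) one_pos
      exact ⟨P, fun h => absurd h (lt_irrefl 0)⟩
    · obtain ⟨P, hPm, hPl⟩ := CoarseTierTransfer.exists_periodicConfiguration (x N) hN
      exact ⟨P, fun _ => ⟨hPm, hPl⟩⟩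
  choose P hP using hper
  have hPm : ∀ N, 0 < N → (P N).motif = Finset.univ.image (x N) := fun N hN => (hP N hN).1
  have hPl : ∀ N, 0 < N → ∀ g ∈ (P N).lattice, g ≠ 0 → 2 * ∑ k, ‖x N k‖ + 2 ≤ ‖g‖ :=
    fun N hN => (hP N hN).2
  -- the periodisations are `min δ₀ 2`-separated (`N ≥ 1`)
  have hsepP : ∀ N, 0 < N → ∀ u ∈ (P N).points, ∀ v ∈ (P N).points, u ≠ v → min δ₀ 2 ≤ dist u v :=
    fun N hN => stub_rdvSeparatedPoints (hPm N hN) (hPl N hN) (min_le_right _ _)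
      fun i j hij => (min_le_left _ _).trans (hsep N (x N) (hx N) i j hij)
  -- replace `P 0` by `P 1` so that separation holds at every index
  set P' : ℕ → PeriodicConfiguration 3 := fun N => if 0 < N then P N else P 1 with hP'
  have hP'eq : ∀ N, 0 < N → P' N = P N := fun N hN => by simp [hP', hN]
  have hsepP' : ∀ N, ∀ u ∈ (P' N).points, ∀ v ∈ (P' N).points, u ≠ v → min δ₀ 2 ≤ dist u v := by
    intro N
    rcases Nat.eq_zero_or_pos N with rfl | hN
    · simpa [hP'] using hsepP 1 one_pos
    · rw [hP'eq N hN]; exact hsepP N hN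
  have htend : Filter.Tendsto (fun N => (P' N).energyPerParticle lennardJones) Filter.atTop
      (nhds (⨅ Q : PeriodicConfiguration 3, Q.energyPerParticle lennardJones)) := by
    refine (tendsto_energyPerParticle_periodised hx hPm hPl).congr' ?_
    filter_upwards [Filter.eventually_gt_atTop 0] with N hN
    rw [hP'eq N hN]
  obtain ⟨a, ha0, ha1, hθ⟩ := hseq (min δ₀ 2) (lt_min hδ₀ two_pos) P' hsepP' htend
  refine ⟨a, ha0, ha1, fun θ hθpos => ?_⟩
  have ha : 0 < a := by linarith
  refine ((hθ θ hθpos).and_eventually (Filter.eventually_gt_atTop 0)).mono fun N hN => ?_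
  obtain ⟨hbad, hN0⟩ := hN
  rw [hP'eq N hN0] at hbad
  have hcardm : ((P N).motif.card : ℝ) = N := by
    rw [hPm N hN0, Finset.card_image_of_injective _ (hx N).1]
    simp
  rw [card_rdvBadMotif_eq (hPm N hN0) (hPl N hN0) (hx N).1 ha ha1, hcardm] at hbad
  exact hbad

end Summit.AtomisticToContinuum.Crystallization.Theorems

end
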